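import Summits.QuantumFields.YangMills.Theorems.BalabanUVNodesN12RootedForest
import Summits.QuantumFields.YangMills.Theorems.BalabanUVNodesN12FlatHndHarmonicLetter
import HarnessLib

/-!
# BalabanUVNodes ∕ N12 — THE GEOMETRY LETTER OF THE EXPORTED FOREST: the breadth-first rooted forest of `N12RootedForest` is GEODESIC (every path is a shortest lattice path to the root SET,
# `(path x).length ≤ tdist x r` for every root `r`), every fine site lies within half a `j`-block of its `j`-block centre, hence at the record's `𝐁_k(Z)` every site hangs within
# `d·(L^j − 1)∕2` fine steps for EVERY member tower it lies in — the length half of the comb geometry, exported BY NAME for the (q2) consumer (dag-n12-c g17 ∕ dag-n12-w6 g1)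

Cell `pub-ymgap` (HUMAN RULINGS D-0062 ∕ D-0149), WIDTH SEAT `pub-ymgap-dag-n12-w3` g3 (node N12 = [B15]; key K1⁸ `stmt-QuantumFields-26907`, `--kind proof --supports … --as helper`;
count-neutral).  THEOREMS ONLY (0 `def`, 0 `instance`, 0 `sorry`); consumed BY NAME: this seat's `N12RootedForest.forest_F1` (p618645), `N12FlatHndRecordLetters.hcov_Bj` (p608348);
`T4Continuum.walkEnd_apply` ∕ `walkEnd_append`, `T4ReflectionCone.netDisp_replicate`, `Site.shift_unshift`; the route UnitScaleTilt's `Prop7TentInterpolation.val_embIter`, `B5Eq118OneStroke.val_iterBlockOf`.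

WHY.  dag-n12-c g17 (cell bus 2026-08-28 09:21Z): «export (F1)(F2) of the hierarchical comb BY NAME when convenient — (q2) consumer» ((q2) = Poincaré-in-towers for dag-n12-w6's interior letter
«`dist1 ((σ•U₀) b) ≤ A·ε_j + B·dist1 (M˙ j c)`»).  (F1)(F2)(TREE) are exported by `N12RootedForest.exists_rootedForest_detSet ∕ _Bj`; what a Poincaré ∕ holonomy estimate along the forest
needs in addition is the LENGTH of the paths.  The forest of `N12RootedForest` is a breadth-first forest from the root set; this file re-runs the construction keeping the rank and proves
it GEODESIC: the breadth-first rank is the lattice distance to the root set (a word of length `tdist` exists between any two sites: in each coordinate the shorter way round the torus),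
and every path has length at most its end's rank.  With the elementary `tdist z (embIter j (iterBlockOf j z)) ≤ d·(L^j − 1)∕2` (a site is within half a block of its `j`-block centre in
every coordinate; no wrap, `L^j` odd) this gives at the record: every site hangs within `d·(L^j − 1)∕2` fine steps whenever its `j`-block centre is a member of `𝐁_k(Z)` — the comb's length
bound, indeed the optimal one.  HONEST GEOMETRY NOTE: the exported forest is NOT print's block-hierarchical comb ([Balaban1985RegularSpaces] (1.19) is a gauge on the AVERAGED
configurations and its fine straightening is not a forest — this seat's LOCATED-GAUGE); its paths are shortest but may leave the block tower of their root (they stay in the `tdist`-ball of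
radius `≤ d·(L^j − 1)∕2` about the site).  A tower-CONFINED forest, if (q2) needs one, is a different (cut-comb) construction.

CONTENTS.  §1 `exists_word_length_eq_tdist` (a lattice word of length `tdist x r` from `r` to `x`), ★★ `exists_geodesicForest` (for ANY nonempty root set: (F2) ∧ (TREE) ∧ (GEO)
`∀ x, ∀ r ∈ R, (path x).length ≤ tdist x r`).  §2 `val_sub_val_le_half` (label arithmetic), ★ `tdist_embIter_iterBlockOf_le` (`≤ d·(L^j − 1)∕2`, `j ≤ m + K`).  §3 ★★ `exists_geodesicForest_detSet`
((F1) ∧ (F2) ∧ (TREE) ∧ (GEO) at `R(𝐁, k)`; the tower form `iterBlockOf j z ∈ 𝐁 j → (path z).length ≤ d·(L^j − 1)∕2`), ★★★ `exists_geodesicForest_Bj` (the record, every `Z`; with `hcov_Bj`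
every site has such a `j ≤ k`).

HONEST FRAMING.  Finite graph theory and label arithmetic; no analysis, no constants of Bałaban's; a tree gauge in place of print's (1.19); N12 NOT discharged; K1⁸ NOT closed; counts unmoved
(typed 28∕28 · discharged 5∕27); one finite 𝕋⁴ programme at fixed ε — R4 closes the conditional rung `BalabanLadder.UV` only; the Yang–Mills mass gap (Clay) is NOT proved by any of this;
nothing continuum ∕ ℝ⁴ ∕ OS.
-/

noncomputable section

namespace Summit.QuantumFields.YangMills.BalabanUVNodes.N12RootedForestGeodesic

open scoped BigOperators
open Literature.MathematicalPhysics.QuantumFieldTheory.Balaban1983to89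
open T4Continuum
open B15DeterminingSets
open B5Eq118OneStroke (iterBlockOf val_iterBlockOf)
open Summit.QuantumFields.YangMills.Theorems.Prop7TentInterpolation (val_embIter)
open Summit.QuantumFields.YangMills.BalabanUVNodes.N12RootedForest (forest_F1)

variable {P : Params} {j : ℕ}

/-! ## §1 Geodesic words and the geodesic breadth-first forest -/

section Geodesic

/-- **A SHORTEST LATTICE WORD**: from `r` to `x` there is a word of length `tdist x r` (in each coordinate the shorter way round the torus: `(x_μ − r_μ) mod N` forward steps or
`(r_μ − x_μ) mod N` backward steps). [cite: Balaban1987RG1, (0.1) p.251 (the torus; bookkeeping)] -/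
theorem exists_word_length_eq_tdist (r x : Site P j) : ∃ w : List (Letter P.d), walkEnd r w = x ∧ w.length = Site.tdist x r := by
  classical
  suffices h : ∀ s : Finset (Fin P.d), ∃ w : List (Letter P.d), (∀ ν, walkEnd r w ν = if ν ∈ s then x ν else r ν) ∧
      w.length = ∑ μ ∈ s, min (x μ - r μ).val (r μ - x μ).val by
    obtain ⟨w, hw, hlen⟩ := h Finset.univ
    exact ⟨w, funext fun ν => by rw [hw ν, if_pos (Finset.mem_univ ν)], hlen⟩
  intro s
  refine Finset.induction_on s ⟨[], fun ν => ?_, by simp⟩ ?_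
  · rw [if_neg (Finset.notMem_empty ν)]
    rfl
  · intro μ s hμ ih
    obtain ⟨w, hw, hlen⟩ := ih
    by_cases hle : (x μ - r μ).val ≤ (r μ - x μ).val
    · refine ⟨w ++ List.replicate (x μ - r μ).val (μ, true), fun ν => ?_, ?_⟩
      · rw [walkEnd_append, walkEnd_apply, hw ν, T4ReflectionCone.netDisp_replicate]
        by_cases hν : ν = μ
        · subst hν
          simp [hμ]
        · simp [hν, Ne.symm hν]
      · rw [List.length_append, List.length_replicate, hlen, Finset.sum_insert hμ, min_eq_left hle, add_comm]
    · refine ⟨w ++ List.replicate (r μ - x μ).val (μ, false), fun ν => ?_, ?_⟩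
      · rw [walkEnd_append, walkEnd_apply, hw ν, T4ReflectionCone.netDisp_replicate]
        by_cases hν : ν = μ
        · subst hν
          simp [hμ]
        · simp [hν, Ne.symm hν]
      · rw [List.length_append, List.length_replicate, hlen, Finset.sum_insert hμ, min_eq_right (le_of_not_ge hle), add_comm]

/-- ★★ **THE GEODESIC ROOTED FOREST**: for any nonempty root set `R` of `T^{(j)}` a rooted spanning forest in the `path` currency with (F2) the roots have empty paths, (TREE) every non-root hangs
from a parent by its last oriented step, and (GEO) every path is a SHORTEST lattice path to the root set: `(path x).length ≤ tdist x r` for every `r ∈ R` (breadth-first search; the rank is the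
lattice distance to `R`). [folklore] -/
theorem exists_geodesicForest (R : Set (Site P j)) (hR : R.Nonempty) :
    ∃ path : Site P j → List (LStep P j), (∀ r ∈ R, path r = []) ∧
      (∀ x, x ∉ R → ∃ (x' : Site P j) (s : LStep P j), path x = path x' ++ [s] ∧
        (s.fwd = true → s.bond.src = x' ∧ s.bond.tgt = x) ∧ (s.fwd = false → s.bond.src = x ∧ s.bond.tgt = x')) ∧
      (∀ x, ∀ r ∈ R, (path x).length ≤ Site.tdist x r) := by
  classical
  obtain ⟨r₀, hr₀⟩ := hR
  -- the breadth-first rank = lattice distance to `R`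
  have hreach : ∀ x : Site P j, ∃ n, ∃ r ∈ R, ∃ w : List (Letter P.d), w.length = n ∧ walkEnd r w = x := fun x => by
    obtain ⟨w, hw, -⟩ := exists_word_length_eq_tdist r₀ x
    exact ⟨w.length, r₀, hr₀, w, rfl, hw⟩
  let ρ : Site P j → ℕ := fun x => Nat.find (hreach x)
  have hρle : ∀ x, ∀ r ∈ R, ρ x ≤ Site.tdist x r := fun x r hr => by
    obtain ⟨w, hw, hlen⟩ := exists_word_length_eq_tdist r x
    exact Nat.find_min' (hreach x) ⟨r, hr, w, hlen, hw⟩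
  have hρ : ∀ x, x ∉ R → ∃ (x' : Site P j) (l : Letter P.d), ρ x' < ρ x ∧ walkEnd x' [l] = x := fun x hx => by
    obtain ⟨r, hr, w, hlen, hw⟩ := Nat.find_spec (hreach x)
    rcases w.eq_nil_or_concat with rfl | ⟨w', l, rfl⟩
    · have hrx : r = x := hw
      subst hrx
      exact absurd hr hx
    · rw [List.concat_eq_append] at hlen hw
      refine ⟨walkEnd r w', l, ?_, by rw [← walkEnd_append]; exact hw⟩
      have h1 : Nat.find (hreach (walkEnd r w')) ≤ w'.length := Nat.find_min' _ ⟨r, hr, w', rfl, rfl⟩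
      have h2 : (w' ++ [l]).length = Nat.find (hreach x) := hlen
      rw [List.length_append, List.length_singleton] at h2
      show Nat.find (hreach (walkEnd r w')) < Nat.find (hreach x)
      omega
  -- one oriented step from `x′` to `walkEnd x′ [l]`
  have hstep : ∀ (x' : Site P j) (l : Letter P.d), ∃ s : LStep P j,
      (s.fwd = true → s.bond.src = x' ∧ s.bond.tgt = walkEnd x' [l]) ∧ (s.fwd = false → s.bond.src = walkEnd x' [l] ∧ s.bond.tgt = x') := by
    rintro x' ⟨μ, b⟩
    cases b
    · exact ⟨⟨⟨x'.unshift μ, μ⟩, false⟩, fun h => absurd h Bool.false_ne_true, fun _ => ⟨rfl, Site.shift_unshift x' μ⟩⟩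
    · exact ⟨⟨⟨x', μ⟩, true⟩, fun _ => ⟨rfl, rfl⟩, fun h => absurd h (by simp)⟩
  have hpar : ∀ x : Site P j, ∃ (x' : Site P j) (s : LStep P j), x ∉ R → ρ x' < ρ x ∧
      (s.fwd = true → s.bond.src = x' ∧ s.bond.tgt = x) ∧ (s.fwd = false → s.bond.src = x ∧ s.bond.tgt = x') := by
    intro x
    by_cases hxR : x ∈ R
    · exact ⟨x, ⟨⟨x, ⟨0, P.hd⟩⟩, true⟩, fun h => absurd hxR h⟩
    · obtain ⟨x', l, hlt, hx⟩ := hρ x hxR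
      obtain ⟨s, hs⟩ := hstep x' l
      subst hx
      exact ⟨x', s, fun _ => ⟨hlt, hs⟩⟩
  choose par st hps using hpar
  -- layers, keeping `(path x).length ≤ ρ x`
  have hlayer : ∀ n : ℕ, ∃ path : Site P j → List (LStep P j),
      (∀ x, ρ x ≤ n → x ∉ R → ∃ (x' : Site P j) (s : LStep P j), ρ x' < ρ x ∧ path x = path x' ++ [s] ∧
        (s.fwd = true → s.bond.src = x' ∧ s.bond.tgt = x) ∧ (s.fwd = false → s.bond.src = x ∧ s.bond.tgt = x')) ∧
      (∀ x, (n < ρ x ∨ x ∈ R) → path x = []) ∧ (∀ x, (path x).length ≤ ρ x) := by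
    intro n
    induction n with
    | zero =>
      refine ⟨fun _ => [], fun x hx hxR => ?_, fun _ _ => rfl, fun _ => Nat.zero_le _⟩
      obtain ⟨hlt, -⟩ := hps x hxR
      omega
    | succ n ih =>
      obtain ⟨path, htree, hnil, hlen⟩ := ih
      refine ⟨fun x => if ρ x = n + 1 ∧ x ∉ R then path (par x) ++ [st x] else path x, fun x hx hxR => ?_, fun x hx => ?_, fun x => ?_⟩
      · by_cases hρx : ρ x = n + 1
        · obtain ⟨hlt, hor⟩ := hps x hxR
          refine ⟨par x, st x, hlt, ?_, hor⟩
          have hp : ¬(ρ (par x) = n + 1 ∧ par x ∉ R) := fun h => by omega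
          dsimp only
          rw [if_pos ⟨hρx, hxR⟩, if_neg hp]
        · obtain ⟨x', s, hlt, hpx, hor⟩ := htree x (by omega) hxR
          refine ⟨x', s, hlt, ?_, hor⟩
          have h1 : ¬(ρ x = n + 1 ∧ x ∉ R) := fun h => hρx h.1
          have h2 : ¬(ρ x' = n + 1 ∧ x' ∉ R) := fun h => by omega
          dsimp only
          rw [if_neg h1, if_neg h2, hpx]
      · have h1 : ¬(ρ x = n + 1 ∧ x ∉ R) := by
          rintro ⟨h, h'⟩
          rcases hx with hx | hx
          · omega
          · exact h' hx
        dsimp only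
        rw [if_neg h1]
        exact hnil x (hx.imp (fun h => by omega) id)
      · dsimp only
        split_ifs with h
        · rw [List.length_append, List.length_singleton]
          have := hlen (par x)
          have := (hps x h.2).1
          omega
        · exact hlen x
  obtain ⟨path, htree, hnil, hlen⟩ := hlayer (Finset.univ.sup ρ)
  exact ⟨path, fun r hr => hnil r (Or.inr hr), fun x hxR => by
    obtain ⟨x', s, -, hpx, hor⟩ := htree x (Finset.le_sup (Finset.mem_univ x)) hxR
    exact ⟨x', s, hpx, hor⟩, fun x r hr => (hlen x).trans (hρle x r hr)⟩

end Geodesic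

/-! ## §2 A site is within half a block of its `j`-block centre -/

section Centre

/-- Label arithmetic: for labels `a, c < N₀` with `|a − c| ≤ h` (as naturals, either order), the torus summand `min ((a − c) mod N₀) ((c − a) mod N₀)` is at most `h`. [folklore] -/
theorem min_val_sub_le {n : ℕ} [NeZero n] (a c : ZMod n) (h : ℕ) (h₁ : a.val ≤ c.val + h) (h₂ : c.val ≤ a.val + h) :
    min (a - c).val (c - a).val ≤ h := by
  rcases le_total c.val a.val with hca | hac
  · exact (min_le_left _ _).trans (by rw [ZMod.val_sub hca]; omega)
  · exact (min_le_right _ _).trans (by rw [ZMod.val_sub hac]; omega)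

/-- ★ **A SITE IS WITHIN HALF A BLOCK OF ITS `j`-BLOCK CENTRE**: `tdist z (embIter j (iterBlockOf j z)) ≤ d·(L^j − 1)∕2` (`j ≤ m + K`; labels `a = qL^j + ρ`, centre `qL^j + (L^j − 1)∕2`, `L^j` odd).
[cite: Balaban1987RG1, (0.1)–(0.3) pp.251–252] -/
theorem tdist_embIter_iterBlockOf_le (hj : j ≤ P.m + P.K) (z : Site P 0) :
    Site.tdist z (embIter j (iterBlockOf j z)) ≤ P.d * ((P.L ^ j - 1) / 2) := by
  have hL : 0 < P.L ^ j := pow_pos P.L_pos j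
  have hodd : P.L ^ j % 2 = 1 := Nat.odd_iff.mp (Odd.pow P.hL.1)
  have hsum : Site.tdist z (embIter j (iterBlockOf j z)) ≤ ∑ _μ : Fin P.d, (P.L ^ j - 1) / 2 := by
    refine Finset.sum_le_sum fun μ _ => ?_
    have hc : ((embIter j (iterBlockOf j z)) μ).val = (z μ).val / P.L ^ j * P.L ^ j + (P.L ^ j - 1) / 2 := by
      rw [val_embIter hj, val_iterBlockOf j hj]
    have hdiv := Nat.div_add_mod (z μ).val (P.L ^ j)
    have hmod := Nat.mod_lt (z μ).val hL
    refine min_val_sub_le _ _ _ ?_ ?_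
    · rw [hc]
      have : (z μ).val = P.L ^ j * ((z μ).val / P.L ^ j) + (z μ).val % P.L ^ j := hdiv.symm
      have h2 : (z μ).val % P.L ^ j ≤ P.L ^ j - 1 := by omega
      have h3 : P.L ^ j - 1 ≤ 2 * ((P.L ^ j - 1) / 2) := by omega
      nlinarith [Nat.mul_comm (P.L ^ j) ((z μ).val / P.L ^ j)]
    · rw [hc]
      have : (z μ).val = P.L ^ j * ((z μ).val / P.L ^ j) + (z μ).val % P.L ^ j := hdiv.symm
      nlinarith [Nat.mul_comm (P.L ^ j) ((z μ).val / P.L ^ j), Nat.zero_le ((z μ).val % P.L ^ j)]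
  simpa only [Finset.sum_const, Finset.card_univ, Fintype.card_fin, smul_eq_mul] using hsum

end Centre

/-! ## §3 At a determining set and at the record -/

section Record

open Literature.MathematicalPhysics.QuantumFieldTheory.Balaban1983to89.B14.Eq213DetSet (Bj)
open Literature.MathematicalPhysics.QuantumFieldTheory.Balaban1983to89.B14.Eq213MaximalDomains (side)

/-- ★★ **THE GEODESIC FOREST AT A DETERMINING SET**: for `𝐁` read up to `k ≤ m + K` with at least one constrained bond, a rooted forest with (F1), (F2), (TREE) at `R(𝐁, k)` AND the tower-length
letter: every site hangs within `d·(L^j − 1)∕2` fine steps whenever its `j`-block centre is a member of `𝐁 j` (`j ≤ k`; members are sources of constrained bonds, hence roots).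
[cite: Balaban1985RegularSpaces, (1.14) p.78, (1.19) p.79; Balaban1988Convergent, (2.2) p.255, (2.13) pp.256–257; Balaban1987RG1, (0.1)–(0.3) pp.251–252] -/
theorem exists_geodesicForest_detSet (𝔹 : DetSet P) {k : ℕ} (hk : k ≤ P.m + P.K) (hne : ∃ j, j ≤ k ∧ ∃ c, c ∈ bondsOf (𝔹 j)) :
    ∃ path : Site P 0 → List (LStep P 0),
      (∀ x, ∀ s ∈ path x, ∃ x' x'' : Site P 0, path x'' = path x' ++ [s] ∧
        (s.fwd = true → s.bond.src = x' ∧ s.bond.tgt = x'') ∧ (s.fwd = false → s.bond.src = x'' ∧ s.bond.tgt = x')) ∧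
      (∀ j, j ≤ k → ∀ c ∈ bondsOf (𝔹 j), path (embIter j c.src) = [] ∧ path (embIter j c.tgt) = []) ∧
      (∀ x : Site P 0, x ∉ {z : Site P 0 | ∃ j, j ≤ k ∧ ∃ c ∈ bondsOf (𝔹 j), (z = embIter j c.src ∨ z = embIter j c.tgt)} →
        ∃ (x' : Site P 0) (s : LStep P 0), path x = path x' ++ [s] ∧
          (s.fwd = true → s.bond.src = x' ∧ s.bond.tgt = x) ∧ (s.fwd = false → s.bond.src = x ∧ s.bond.tgt = x')) ∧
      (∀ (z : Site P 0) (j : ℕ), j ≤ k → iterBlockOf j z ∈ 𝔹 j → (path z).length ≤ P.d * ((P.L ^ j - 1) / 2)) := by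
  obtain ⟨j₀, hj₀, c₀, hc₀⟩ := hne
  obtain ⟨path, hroot, htree, hgeo⟩ := exists_geodesicForest
    {z : Site P 0 | ∃ j, j ≤ k ∧ ∃ c ∈ bondsOf (𝔹 j), (z = embIter j c.src ∨ z = embIter j c.tgt)} ⟨embIter j₀ c₀.src, j₀, hj₀, c₀, hc₀, Or.inl rfl⟩
  refine ⟨path, forest_F1 hroot htree, fun j hj c hc => ⟨hroot _ ⟨j, hj, c, hc, Or.inl rfl⟩, hroot _ ⟨j, hj, c, hc, Or.inr rfl⟩⟩, htree,
    fun z j hj hz => ?_⟩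
  have hmem : embIter j (iterBlockOf j z) ∈ {z : Site P 0 | ∃ j, j ≤ k ∧ ∃ c ∈ bondsOf (𝔹 j), (z = embIter j c.src ∨ z = embIter j c.tgt)} :=
    ⟨j, hj, ⟨iterBlockOf j z, ⟨0, P.hd⟩⟩, Or.inl hz, Or.inl rfl⟩
  exact (hgeo z _ hmem).trans (tdist_embIter_iterBlockOf_le (hj.trans hk) z)

/-- ★★★ **THE GEODESIC FOREST AT THE RECORD's `𝐁_k(Z)`, EVERY `Z`**: (F1) ∧ (F2) ∧ (TREE) at `R(𝐁_k(Z), k)` ∧ the tower-length letter `iterBlockOf j z ∈ 𝐁_k(Z) j → (path z).length ≤ d·(L^j − 1)∕2`;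
by `N12FlatHndRecordLetters.hcov_Bj` every fine site has such a `j ≤ k`, so every site hangs within half a block, at its own scale, of fine steps.
[cite: Balaban1988Convergent, (2.2) p.255, (2.13) pp.256–257; Balaban1985RegularSpaces, (1.19) p.79; Balaban1987RG1, (0.1)–(0.3) pp.251–252] -/
theorem exists_geodesicForest_Bj {k M₁ : ℕ} {Z : Set (Site P 0)} (hk : k ≤ P.m + P.K) (hk1 : 1 ≤ k) (hM : 1 ≤ M₁) (hdiv : side P.L M₁ k ∣ P.sitesPerDir 0) :
    ∃ path : Site P 0 → List (LStep P 0),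
      (∀ x, ∀ s ∈ path x, ∃ x' x'' : Site P 0, path x'' = path x' ++ [s] ∧
        (s.fwd = true → s.bond.src = x' ∧ s.bond.tgt = x'') ∧ (s.fwd = false → s.bond.src = x'' ∧ s.bond.tgt = x')) ∧
      (∀ j, j ≤ k → ∀ c ∈ bondsOf ((Bj M₁ Z k : DetSet P) j), path (embIter j c.src) = [] ∧ path (embIter j c.tgt) = []) ∧
      (∀ x : Site P 0, x ∉ {z : Site P 0 | ∃ j, j ≤ k ∧ ∃ c ∈ bondsOf ((Bj M₁ Z k : DetSet P) j), (z = embIter j c.src ∨ z = embIter j c.tgt)} →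
        ∃ (x' : Site P 0) (s : LStep P 0), path x = path x' ++ [s] ∧
          (s.fwd = true → s.bond.src = x' ∧ s.bond.tgt = x) ∧ (s.fwd = false → s.bond.src = x ∧ s.bond.tgt = x')) ∧
      (∀ (z : Site P 0) (j : ℕ), j ≤ k → iterBlockOf j z ∈ (Bj M₁ Z k : DetSet P) j → (path z).length ≤ P.d * ((P.L ^ j - 1) / 2)) ∧
      (∀ z : Site P 0, ∃ j, j ≤ k ∧ (path z).length ≤ P.d * ((P.L ^ j - 1) / 2)) := by
  obtain ⟨j, hj, hy⟩ := N12FlatHndRecordLetters.hcov_Bj hM hk1 hk hdiv (default : Site P 0)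
  obtain ⟨path, h1, h2, h3, h4⟩ := exists_geodesicForest_detSet (Bj M₁ Z k) hk ⟨j, hj, ⟨iterBlockOf j default, ⟨0, P.hd⟩⟩, Or.inl hy⟩
  refine ⟨path, h1, h2, h3, h4, fun z => ?_⟩
  obtain ⟨j', hj', hz⟩ := N12FlatHndRecordLetters.hcov_Bj hM hk1 hk hdiv z
  exact ⟨j', hj', h4 z j' hj' hz⟩

end Record

end Summit.QuantumFields.YangMills.BalabanUVNodes.N12RootedForestGeodesic

end
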